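import Summits.QuantumFields.YangMills.Theorems.BalabanUVNodesN08HaarCompatibilityGuardMixtureDensity
import Summits.QuantumFields.YangMills.Theorems.BalabanUVNodesN08HaarCompatibilityGuardAdmitting

/-!
# BalabanUVNodes ∕ N08 — THE ONE-STEP EXTENSIVE TRANSPORT BOUND FOR THE TYPED (0.4) AVERAGING, MODULO THE GUARDED-BRANCH DENSITY CONSTANT:
# `h^{n} · Ū_*(dU) ≤ (h + (K−1)·h(2δ)^{L^{d−1}−1})^{n} · dV`, `n = #PBond(j+1)`, i.e. `density(Ū_*(dU)) ≤ (1 + (K−1)s)^{n}`, `s = h(2δ)^{L^{d−1}−1}∕h(δ)`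

WIDTH SEAT `pub-ymgap-dag-n08-w3` g4, `W-SEAT-START-LIST.md` v10 §0 (iii); item-3 lineage part 20 = THE CAPSTONE of parts 13–19, 2026-08-28.  DAG node N08 =
[Balaban1985UV3] Thm 1 p. 257 (compact) + Thm 2 p. 272; key item K1⁷ `StabilityBAtRecordR13SepCoPH` (stmt-QuantumFields-20542), `--supports … --as helper`.  COUNT-NEUTRAL.

THE POINT.  n08-w1's (R4⁗)∕(R4⁵) located the analytic input that REPLACES E6′ in N08 as an extensive bound on the transports of print's averaging; its one-step
form is a bound on the density of `Ū_*(dU)` w.r.t. `dV`.  This file proves that bound for every small-loop average `ℰ` (radius `δ`), every group, in the standing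
range, MODULO ONE ANALYTIC HYPOTHESIS on the one-variable fibre maps — the density constant `K` of the GUARDED branch:
  (H_K)  for every background `U` and coarse bond `c` at which SOME private coordinate enters the guard (`∃ g, Small ℰ (U[β(c) ↦ g]) c`),
         the fibre law `Haar ∘ (g ↦ Ū(c)(U[β(c) ↦ g]))⁻¹` is `≤ K · Haar`
(for the printed exp-mean-log average `K` is what n08-w6's sharp Jacobian bound `|det D K_W| ≥ (L^{1−d})^{N²−1}` (p609767) gives through a quantitative
local-diffeomorphism engine — NOT typed here).  Then (★★★ `smul_map_avgFun_le`):

  `h(δ′)^{n} • Ū_*(dU) ≤ (h(δ′) + (K − 1)·h(δ + δ′)^{L^{d−1}−1})^{n} • dV`,   `n = #PBond(j+1)`, `h(r) = Haar{dist1 < r}`, every `δ′`;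

read with `δ′ = δ`: `density(Ū_*(dU)) ≤ (1 + (K−1)·s)^{#PBond(j+1)}`, `s = h(2δ)^{L^{d−1}−1}∕h(δ)` — EXTENSIVE IN THE COARSE LATTICE with an honest per-bond
constant `log(1 + (K−1)s) ≤ (K−1)s`.  Assembly: off the guard-admitting backgrounds the fibre map IS the Haar translation `g ↦ pre·g·post` (`map_fibre_eq_haar_of_not_exists`,
pub-balaban's `avgFun_of_not_small` + `axialAvg_update_centralBond`), so the per-fibre domination holds with `A_c(U) = 1 + (K−1)·1[U ∈ GA♯_c]` (part 19's measurable
super-event); part 16 (`map_avgFun_le_lintegral_smul`) integrates it; the expansion `∫ Π_c (1 + a·1_{E_c}) = Σ_S a^{|S|}·μ(∩_S E_c)` (`lintegral_prod_one_add_indicator_le`,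
Mathlib `Finset.prod_add` ∕ `Finset.prod_boole`) and part 19's joint bound `h(δ′)^{|S|}·dU(∩_S GA♯_c) ≤ h(δ+δ′)^{|S|·(L^{d−1}−1)}` resum to the binomial.  §3: the same at
the [B10] slot `avOfPrint N S j` on `SU(N)`, every `N`.

WHAT THIS IS NOT.  Not a bound on print's averaging outright: (H_K) is a HYPOTHESIS (the engine is missing; `K` finite is plausible — numerically the guarded fibre map
is a global `(1−Σcᵢ)`-expansion, HOME note `N08-EML-JACOBIAN.md` §2 — but NOT in the tree).  Not `hmass`: per-level bounds compose to fine-lattice-extensive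
constants; the k-uniform letter needs the no-stacking structure (note §4).  E6′ NOT decided; count-neutral; N08 NOT discharged; counts unmoved (typed 28∕28 ·
discharged 5∕27); one finite 𝕋⁴ programme at fixed ε — R4 closes the CONDITIONAL rung `BalabanLadder.UV` only; the Yang–Mills mass gap (Clay) is NOT proved;
nothing continuum ∕ OS.  [folklore] measure theory; nothing of Bałaban's asserted; 0 `sorry`, 0 `def`, standard axioms.
-/

noncomputable section

open MeasureTheory Function
open scoped ENNReal

namespace Summit.QuantumFields.YangMills.BalabanUVNodes.N08HaarCompatibilityGuardOneStepBound

open Literature.MathematicalPhysics.QuantumFieldTheory.Balaban1983to89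
open Literature.MathematicalPhysics.QuantumFieldTheory.Balaban1983to89.AveragingRT (axialAvg)
open Literature.MathematicalPhysics.QuantumFieldTheory.Balaban1983to89.BlockAveraging (Idx off loopHol Small avgFun measurable_avgFun)
open Literature.MathematicalPhysics.QuantumFieldTheory.Balaban1983to89.BlockAveragingHaarAC
  (IsCentral centralBond pre post axialAvg_update_centralBond avgFun_of_not_small)
open Summit.QuantumFields.YangMills.BalabanUVNodes.N08HaarCompatibilityGuardMixtureDensity (map_avgFun_le_lintegral_smul)
open Summit.QuantumFields.YangMills.BalabanUVNodes.N08HaarCompatibilityGuardAdmitting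
  (measurable_haar_crossSmall_update setOf_exists_small_subset measure_forall_guardSharp_le)

/-! ## §1 The expansion: `∫ Π_c (1 + a·1_{E_c}) ≤ (h + a·t)^n ∕ h^n` from the joint bounds `h^{|S|}·μ(∩_S E_c) ≤ t^{|S|}` -/

section Expansion

variable {X : Type*} [MeasurableSpace X] {ι : Type*} [Fintype ι] [DecidableEq ι]

omit [MeasurableSpace X] in
/-- A product of scaled indicators is the scaled indicator of the intersection (plumbing). [folklore] -/
theorem prod_mul_indicator_one (E : ι → Set X) (a : ℝ≥0∞) (S : Finset ι) (x : X) :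
    ∏ c ∈ S, a * (E c).indicator (fun _ => (1 : ℝ≥0∞)) x = a ^ S.card * {y : X | ∀ c ∈ S, y ∈ E c}.indicator (fun _ => (1 : ℝ≥0∞)) x := by
  rw [Finset.prod_mul_distrib, Finset.prod_const]
  congr 1
  by_cases hx : ∀ c ∈ S, x ∈ E c
  · rw [Set.indicator_of_mem (show x ∈ {y : X | ∀ c ∈ S, y ∈ E c} from hx)]
    exact Finset.prod_eq_one fun c hc => Set.indicator_of_mem (hx c hc) _
  · rw [Set.indicator_of_notMem (show x ∉ {y : X | ∀ c ∈ S, y ∈ E c} from hx)]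
    push Not at hx
    obtain ⟨c, hc, hxc⟩ := hx
    exact Finset.prod_eq_zero hc (Set.indicator_of_notMem hxc _)

/-- ★ **THE EXPANSION BOUND**: for measurable events `E_c` with joint bounds `h^{|S|}·μ{∀ c ∈ S, E_c} ≤ t^{|S|}` for every finset `S`, and any `a`:
`h^{n}·∫ Π_c (1 + a·1_{E_c}) dμ ≤ (h + a·t)^{n}`, `n = #ι` (`Π_c(1 + a·1_{E_c}) = Σ_S a^{|S|}·1_{∩_S E_c}`, Mathlib `Finset.prod_add` twice). [folklore] -/
theorem lintegral_prod_one_add_indicator_le (μ : Measure X) (E : ι → Set X) (hE : ∀ c, MeasurableSet (E c)) (a h t : ℝ≥0∞)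
    (hjoint : ∀ S : Finset ι, h ^ S.card * μ {x : X | ∀ c ∈ S, x ∈ E c} ≤ t ^ S.card) :
    h ^ Fintype.card ι * ∫⁻ x, ∏ c, (1 + a * (E c).indicator (fun _ => (1 : ℝ≥0∞)) x) ∂μ ≤ (h + a * t) ^ Fintype.card ι := by
  classical
  have hES : ∀ S : Finset ι, MeasurableSet {x : X | ∀ c ∈ S, x ∈ E c} := fun S => by
    rw [show {x : X | ∀ c ∈ S, x ∈ E c} = ⋂ c ∈ S, E c by ext x; simp]
    exact S.measurableSet_biInter fun c _ => hE c
  have hmeasS : ∀ S : Finset ι, Measurable fun x => ∏ c ∈ S, a * (E c).indicator (fun _ => (1 : ℝ≥0∞)) x := fun S =>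
    Finset.measurable_prod _ fun c _ => measurable_const.mul (measurable_const.indicator (hE c))
  -- expand the product over the coarse bonds
  have hexp : ∀ x : X, ∏ c, (1 + a * (E c).indicator (fun _ => (1 : ℝ≥0∞)) x) =
      ∑ S ∈ (Finset.univ : Finset ι).powerset, ∏ c ∈ S, a * (E c).indicator (fun _ => (1 : ℝ≥0∞)) x := by
    intro x
    rw [Finset.prod_congr rfl fun c _ => add_comm (1 : ℝ≥0∞) _, Finset.prod_add]
    exact Finset.sum_congr rfl fun S _ => by rw [Finset.prod_const_one, mul_one]
  simp_rw [hexp]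
  rw [lintegral_finsetSum _ fun S _ => hmeasS S, Finset.mul_sum]
  -- the binomial on the right
  have hrhs : (h + a * t) ^ Fintype.card ι = ∑ S ∈ (Finset.univ : Finset ι).powerset, (a * t) ^ S.card * h ^ (Fintype.card ι - S.card) := by
    rw [← Finset.card_univ, ← Finset.prod_const, Finset.prod_congr rfl fun c _ => add_comm h (a * t), Finset.prod_add]
    refine Finset.sum_congr rfl fun S hS => ?_
    rw [Finset.prod_const, Finset.prod_const, Finset.card_sdiff_of_subset (Finset.mem_powerset.1 hS)]
  rw [hrhs]
  refine Finset.sum_le_sum fun S hS => ?_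
  -- one term: `h^n · a^{|S|} μ(∩_S E) ≤ (a t)^{|S|} h^{n − |S|}`
  have hcard : S.card ≤ Fintype.card ι := by rw [← Finset.card_univ]; exact Finset.card_le_card (Finset.mem_powerset.1 hS)
  rw [lintegral_congr fun x => prod_mul_indicator_one E a S x, lintegral_const_mul _ (measurable_const.indicator (hES S)),
    lintegral_indicator_const (hES S), one_mul]
  have hpow : h ^ Fintype.card ι = h ^ (Fintype.card ι - S.card) * h ^ S.card := by rw [← pow_add, Nat.sub_add_cancel hcard]
  calc h ^ Fintype.card ι * (a ^ S.card * μ {x : X | ∀ c ∈ S, x ∈ E c})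
      = a ^ S.card * h ^ (Fintype.card ι - S.card) * (h ^ S.card * μ {x : X | ∀ c ∈ S, x ∈ E c}) := by rw [hpow]; ring
    _ ≤ a ^ S.card * h ^ (Fintype.card ι - S.card) * t ^ S.card := mul_le_mul' le_rfl (hjoint S)
    _ = (a * t) ^ S.card * h ^ (Fintype.card ι - S.card) := by rw [mul_pow]; ring

end Expansion

/-! ## §2 The one-step bound for the typed (0.4) averaging, modulo the guarded-branch density constant -/

section OneStep

variable {P : Params} {j : ℕ} {G : Type*} [GaugeGroup G] (ℰ : LoopAverage G) [MeasurableSpace G] [RegularGaugeGroup G] [HaarData G]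

/-- **OFF THE GUARD-ADMITTING BACKGROUNDS THE FIBRE LAW IS HAAR EXACTLY**: if NO private coordinate brings `c` into the guard at `U`, the fibre map is the
translation `g ↦ pre·g·post`, whose image of Haar is Haar (standing range). [cite: Balaban1987RG1, (0.4) p.253 (bookkeeping)] -/
theorem map_fibre_eq_haar_of_not_exists (hj : j + 1 ≤ P.m + P.K) (U : GaugeField P j G) (c : PBond P (j + 1))
    (hno : ¬ ∃ g : G, Small ℰ (update U (centralBond c) g) c) :
    (HaarData.haar : Measure G).map (fun g => avgFun ℰ (update U (centralBond c) g) c) = HaarData.haar := by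
  classical
  have hfun : (fun g => avgFun ℰ (update U (centralBond c) g) c) = fun g => pre U c * g * post U c := by
    funext g
    rw [avgFun_of_not_small ℰ _ _ fun h => hno ⟨g, h⟩, axialAvg_update_centralBond hj]
  rw [hfun, show (fun g => pre U c * g * post U c) = (fun g => g * post U c) ∘ (fun g => pre U c * g) from rfl,
    ← Measure.map_map (measurable_mul_const _) (measurable_const_mul _), HaarData.map_mul_left, HaarData.map_mul_right]

/-- ★★★ **THE ONE-STEP EXTENSIVE TRANSPORT BOUND MODULO (H_K)**: for every small-loop average `ℰ` (radius `δ`), every `δ′`, and a constant `K ∈ [1, ∞)` dominating the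
guarded fibre laws (H_K): `h(δ′)^{n} • Ū_*(dU) ≤ (h(δ′) + (K − 1)·h(δ + δ′)^{L^{d−1}−1})^{n} • dV`, `n = #PBond(j+1)` — i.e. with `δ′ = δ` the density of `Ū_*(dU)`
is at most `(1 + (K−1)·h(2δ)^{L^{d−1}−1}∕h(δ))^{#PBond(j+1)}`, extensive in the coarse lattice (standing range, every group).
[cite: Balaban1987RG1, (0.4) p.253 (the typed averaging; bookkeeping — the bound is NOT in print)] -/
theorem smul_map_avgFun_le (hj : j + 1 ≤ P.m + P.K) (hE : ∀ n, Measurable fun W : Fin (n + 1) → G => ℰ.E W) {K : ℝ≥0∞} (hK1 : 1 ≤ K) (hKtop : K ≠ ∞)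
    (hK : ∀ (c : PBond P (j + 1)) (U : GaugeField P j G), (∃ g : G, Small ℰ (update U (centralBond c) g) c) →
      (HaarData.haar : Measure G).map (fun g => avgFun ℰ (update U (centralBond c) g) c) ≤ K • (HaarData.haar : Measure G))
    (δ' : ℝ) :
    (HaarData.haar : Measure G) {g : G | dist1 g < δ'} ^ Fintype.card (PBond P (j + 1)) • (fieldMeasure P j G).map (avgFun ℰ) ≤
      ((HaarData.haar : Measure G) {g : G | dist1 g < δ'} +
          (K - 1) * (HaarData.haar : Measure G) {g : G | dist1 g < ℰ.δ + δ'} ^ (P.L ^ (P.d - 1) - 1)) ^ Fintype.card (PBond P (j + 1)) •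
        fieldMeasure P (j + 1) G := by
  classical
  haveI := HaarData.isProb (G := G)
  -- the measurable super-events of part 19 and the weights `A_c = 1 + (K−1)·1[GA♯_c]`
  set E : PBond P (j + 1) → Set (GaugeField P j G) := fun c =>
    {U | (HaarData.haar : Measure G) {g : G | dist1 g < δ'} ≤ (HaarData.haar : Measure G)
      {g : G | ∀ r : {r : Fin P.d → Fin P.L // off r c.dir = 0 ∧ ¬ IsCentral c (r, 1, 1)},
        dist1 (loopHol (update U (centralBond c) g) c (r.1, 1, 1)) < ℰ.δ + δ'}} with hEdef
  have hEm : ∀ c, MeasurableSet (E c) := fun c =>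
    measurableSet_le measurable_const (measurable_haar_crossSmall_update c (ℰ.δ + δ'))
  set A : PBond P (j + 1) → GaugeField P j G → ℝ≥0∞ := fun c U => 1 + (K - 1) * (E c).indicator (fun _ => (1 : ℝ≥0∞)) U with hAdef
  have hAm : ∀ c, Measurable (A c) := fun c =>
    show Measurable fun U => 1 + (K - 1) * (E c).indicator (fun _ => (1 : ℝ≥0∞)) U from
      ((measurable_const.indicator (hEm c)).const_mul (K - 1)).const_add 1
  have hA0 : ∀ c U, A c U ≠ 0 := fun c U => ne_of_gt (lt_of_lt_of_le zero_lt_one le_self_add)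
  have hAtop : ∀ c U, A c U ≠ ∞ := fun c U => by
    refine ENNReal.add_ne_top.2 ⟨ENNReal.one_ne_top, ENNReal.mul_ne_top (ENNReal.sub_ne_top hKtop) ?_⟩
    by_cases hU : U ∈ E c <;> simp [Set.indicator, hU]
  -- the per-fibre domination
  have hdom : ∀ (c : PBond P (j + 1)) (U : GaugeField P j G),
      (HaarData.haar : Measure G).map (fun g => avgFun ℰ (update U (centralBond c) g) c) ≤ A c U • (HaarData.haar : Measure G) := by
    intro c U
    by_cases hga : ∃ g : G, Small ℰ (update U (centralBond c) g) c
    · have hUE : U ∈ E c := setOf_exists_small_subset ℰ hj c δ' hga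
      have hAK : A c U = K := by
        show 1 + (K - 1) * (E c).indicator (fun _ => (1 : ℝ≥0∞)) U = K
        rw [Set.indicator_of_mem hUE, mul_one, add_tsub_cancel_of_le hK1]
      rw [hAK]; exact hK c U hga
    · rw [map_fibre_eq_haar_of_not_exists ℰ hj U c hga]
      refine Measure.le_iff.2 fun s _ => ?_
      rw [Measure.smul_apply, smul_eq_mul]
      calc (HaarData.haar : Measure G) s = 1 * (HaarData.haar : Measure G) s := (one_mul _).symm
        _ ≤ A c U * (HaarData.haar : Measure G) s := mul_le_mul' (show (1 : ℝ≥0∞) ≤ A c U from le_self_add) le_rfl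
  -- part 16: the mixture bound
  have hmix := map_avgFun_le_lintegral_smul ℰ hj hE A hAm hA0 hAtop hdom
  -- part 19: the joint bounds of the super-events, in the shape of §1
  have hjoint : ∀ S : Finset (PBond P (j + 1)),
      (HaarData.haar : Measure G) {g : G | dist1 g < δ'} ^ S.card * fieldMeasure P j G {U : GaugeField P j G | ∀ c ∈ S, U ∈ E c} ≤
        ((HaarData.haar : Measure G) {g : G | dist1 g < ℰ.δ + δ'} ^ (P.L ^ (P.d - 1) - 1)) ^ S.card := by
    intro S
    calc (HaarData.haar : Measure G) {g : G | dist1 g < δ'} ^ S.card * fieldMeasure P j G {U : GaugeField P j G | ∀ c ∈ S, U ∈ E c}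
        ≤ (HaarData.haar : Measure G) {g : G | dist1 g < ℰ.δ + δ'} ^ (S.card * (P.L ^ (P.d - 1) - 1)) := measure_forall_guardSharp_le hj ℰ.δ δ' S
      _ = _ := by rw [mul_comm, pow_mul]
  -- §1: the expansion
  have hexp := lintegral_prod_one_add_indicator_le (fieldMeasure P j G) E hEm (K - 1) ((HaarData.haar : Measure G) {g : G | dist1 g < δ'})
    ((HaarData.haar : Measure G) {g : G | dist1 g < ℰ.δ + δ'} ^ (P.L ^ (P.d - 1) - 1)) hjoint
  -- assembly, set by set
  refine Measure.le_iff.2 fun s hs => ?_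
  have hmixs := hmix s
  simp only [Measure.smul_apply, smul_eq_mul] at hmixs ⊢
  calc (HaarData.haar : Measure G) {g : G | dist1 g < δ'} ^ Fintype.card (PBond P (j + 1)) * (fieldMeasure P j G).map (avgFun ℰ) s
      ≤ (HaarData.haar : Measure G) {g : G | dist1 g < δ'} ^ Fintype.card (PBond P (j + 1)) * ((∫⁻ U, ∏ c, A c U ∂(fieldMeasure P j G)) * fieldMeasure P (j + 1) G s) :=
        mul_le_mul' le_rfl hmixs
    _ = (HaarData.haar : Measure G) {g : G | dist1 g < δ'} ^ Fintype.card (PBond P (j + 1)) * (∫⁻ U, ∏ c, A c U ∂(fieldMeasure P j G)) *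
          fieldMeasure P (j + 1) G s := by rw [mul_assoc]
    _ ≤ _ := mul_le_mul' hexp le_rfl

end OneStep

/-! ## §3 At the [B10] slot's averaging `avOfPrint N S j` on `SU(N)` -/

section Slot

open Literature.MathematicalPhysics.QuantumFieldTheory.Balaban1985CMP102.Setting (Scales)
open Literature.MathematicalPhysics.QuantumFieldTheory.Balaban1983to89.B10RunsOfRecord (avOfPrint)
open Literature.MathematicalPhysics.QuantumFieldTheory.Balaban1983to89.ExpMeanLog (expMeanLogSU expMeanLogSU_δ measurable_expMeanLogSU_E)
open Literature.MathematicalPhysics.QuantumFieldTheory.Balaban1983to89.Node00 (SU)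
open Summit.QuantumFields.YangMills.BalabanUVNodes.N08HaarCompatibilityGuard (avOfPrint_avg_of_le)

variable (N : ℕ) [NeZero N] {L : ℕ}

/-- ★★★ **AT THE SLOT** (print's own averaging on `SU(N)`, every `N`, standing range, `d = 3` so the exponent is `L² − 1`): under (H_K) for the printed
exp-mean-log fibre maps, `h(δ′)^{n} • (avOfPrint)_*(dU) ≤ (h(δ′) + (K−1)·h(δ_N + δ′)^{L^{d−1}−1})^{n} • dV`, `n = #PBond(j+1)`, `δ_N = min(1∕3, π∕N)`.
[cite: Balaban1985UV3, (2) p.256; Balaban1987RG1, (0.4) p.253 (bookkeeping — the bound is NOT in print)] -/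
theorem smul_map_avOfPrint_le (S₀ : Scales L) {j : ℕ} (hj : j + 1 ≤ S₀.P.m + S₀.P.K) {K : ℝ≥0∞} (hK1 : 1 ≤ K) (hKtop : K ≠ ∞)
    (hK : ∀ (c : PBond S₀.P (j + 1)) (U : GaugeField S₀.P j (SU N)),
      (∃ g : SU N, Small (expMeanLogSU : LoopAverage (SU N)) (update U (centralBond c) g) c) →
        (HaarData.haar : Measure (SU N)).map (fun g => avgFun (expMeanLogSU : LoopAverage (SU N)) (update U (centralBond c) g) c) ≤
          K • (HaarData.haar : Measure (SU N)))
    (δ' : ℝ) :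
    (HaarData.haar : Measure (SU N)) {g : SU N | dist1 g < δ'} ^ Fintype.card (PBond S₀.P (j + 1)) • (fieldMeasure S₀.P j (SU N)).map (avOfPrint N S₀ j).avg ≤
      ((HaarData.haar : Measure (SU N)) {g : SU N | dist1 g < δ'} +
          (K - 1) * (HaarData.haar : Measure (SU N)) {g : SU N | dist1 g < min (1 / 3) (Real.pi / N) + δ'} ^ (S₀.P.L ^ (S₀.P.d - 1) - 1)) ^
            Fintype.card (PBond S₀.P (j + 1)) •
        fieldMeasure S₀.P (j + 1) (SU N) := by
  have h := smul_map_avgFun_le (expMeanLogSU : LoopAverage (SU N)) hj measurable_expMeanLogSU_E hK1 hKtop hK δ'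
  rw [expMeanLogSU_δ, Fintype.card_fin] at h
  rwa [avOfPrint_avg_of_le N S₀ hj]

end Slot

end Summit.QuantumFields.YangMills.BalabanUVNodes.N08HaarCompatibilityGuardOneStepBound
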